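import Literature.NumberTheory.Automorphic.QuaternionAlgebraStructure
import Literature.NumberTheory.QuadraticForms.HilbertSymbolQuaternion
import Literature.NumberTheory.QuadraticForms.HilbertReciprocityFiniteness
import Literature.NumberTheory.QuadraticForms.HilbertSymbolArchimedean
import HarnessLib

/-!
# Ramification of a quaternion algebra via Hilbert symbols; parity reduced to Hilbert reciprocity

Topic `NumberTheory/Automorphic`; namespace `Literature.Automorphic`. Companion ("proofs") file of
`QuaternionAlgebraAdelic` for the named fact `even_card_ramified` (Vignéras, LNM 800, Ch. III
§3 Thm. 3.1: a quaternion algebra over a number field is ramified at an even number of places,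
finite and infinite). All declarations here are fully proved theorems.

The classical proof in characteristic `≠ 2` (Vignéras III §3, remark before Cor. 3.3: "ce
résultat est équivalent à la loi de réciprocité du symbole de Hilbert"; O'Meara §71) has three
inputs:

1. **Structure theorem**: every quaternion algebra `D` over `K` (`IsQuaternionAlgebra K D`) is
   `≃ₐ[K] ℍ[K,a,b]` for some `a b ∈ K×` — `IsQuaternionAlgebra.exists_algEquiv_quaternionAlgebra`
   of `QuaternionAlgebraStructure.lean` (Vignéras Ch. I §1 p. 2).
2. `D ≃ ℍ[K,a,b]` is split at a place `v` iff the Hilbert symbol `(a, b)_v` is `1` — **proved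
   here** (`isSplitAt_iff_hilbertSymbol_eq_one`, `isSplitAtInfinite_iff_hilbertSymbol_eq_one`) by
   transporting `IsSplitAt` along `D ≃ ℍ[K,a,b]` (`isSplitAt_congr`, `isSplitAtInfinite_congr`)
   and combining `isSplitAt_quaternionAlgebra_iff` (`QuaternionAlgebraSplitting`: base change +
   Vignéras I Cor. 2.4) with `exists_sq_sub_mul_sq_iff_hilbertSymbol_eq_one`
   (`HilbertSymbolQuaternion`); hence `Ram_f(D) = {v : (a, b)_v = -1}` and
   `Ram_∞(D) = {w : (a, b)_w = -1} = {w real : σ_w(a) < 0, σ_w(b) < 0}`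
   (`ramifiedPlaces_eq_of_algEquiv`, `ramifiedInfinitePlaces_eq_of_algEquiv`,
   `ramifiedInfinitePlaces_eq_setOf_neg`; Vignéras Ch. III §1 Exemple: "une place v de K se
   ramifie dans {a,b} si et seulement si le symbole de Hilbert (a,b)_v ... est égal à -1").
3. **Hilbert's reciprocity law** (O'Meara 71:18; Vignéras III Cor. 3.3) — the named fact
   `Literature.NumberTheory.QuadraticForms.hilbertReciprocity` of `Literature/NumberTheory/QuadraticForms/HilbertSymbol.lean`. Its
   finiteness half is proved in `HilbertReciprocityFiniteness.lean`; the product formula half is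
   quadratic class field theory in general (proved for `K = ℚ` step by step in the
   `HilbertSymbolRat*` files), and is the only unproved input.

Assembly: `even_card_ramified_of_hilbertReciprocity : (∀ a b, hilbertReciprocity K a b) →
even_card_ramified K D`. (The finiteness of `Ram_f(D)`, Vignéras III §1 Lemme 1.1, is
`ramifiedPlaces_finite_holds` of `QuaternionAlgebraAdelicRamificationProofs.lean`; here it also
follows from 1, 2 and `finite_setOf_hilbertSymbol_eq_neg_one`: `finite_ramifiedPlaces'`.)

## References

* M.-F. Vignéras, *Arithmétique des algèbres de quaternions*, LNM 800 (1980), Ch. I §1, §2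
  Cor. 2.4; Ch. III §1 (Exemple, Lemme 1.1), §3 Thm. 3.1, Cor. 3.3.
* O. T. O'Meara, *Introduction to quadratic forms* (1963), Prop. 57:9, §63B, Thm. 71:18.
-/

noncomputable section

open scoped TensorProduct Quaternion
open NumberField IsDedekindDomain

universe u

namespace Literature.NumberTheory.Automorphic

/-! ### Splitting is an isomorphism invariant -/

section Transport

variable (K : Type*) [Field K] (R : Type*) [CommRing R] [Algebra K R]
  {D : Type*} [Ring D] [Algebra K D] {D' : Type*} [Ring D'] [Algebra K D']

/-- Scalar extension is functorial in `K`-algebra isomorphisms: `D ≃ₐ[K] D'` induces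
`R ⊗_K D ≃ₐ[R] R ⊗_K D'` (Mathlib `Algebra.TensorProduct.congr`, on the type synonym
`ScalarExtension` via the identity `ScalarExtension.ofTensor`), so `R ⊗_K D` and `R ⊗_K D'` have
the same `R`-algebra isomorphisms to any `C`. [folklore] -/
theorem ScalarExtension.nonempty_algEquiv_iff_of_algEquiv (e : D ≃ₐ[K] D') (C : Type*) [Ring C]
    [Algebra R C] :
    Nonempty (ScalarExtension K R D ≃ₐ[R] C) ↔ Nonempty (ScalarExtension K R D' ≃ₐ[R] C) := by
  let f : ScalarExtension K R D ≃ₐ[R] ScalarExtension K R D' :=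
    (ScalarExtension.ofTensor K R D).symm.trans
      ((Algebra.TensorProduct.congr (AlgEquiv.refl : R ≃ₐ[R] R) e).trans
        (ScalarExtension.ofTensor K R D'))
  exact ⟨fun ⟨g⟩ ↦ ⟨f.symm.trans g⟩, fun ⟨g⟩ ↦ ⟨f.trans g⟩⟩

end Transport

/-! ### Ramification of `D ≃ ℍ[K,a,b]` and the Hilbert symbol -/

section NumberField

variable (K : Type) [Field K] [NumberField K] (D : Type u) [Ring D] [Algebra K D]

/-- Being split at a finite place is invariant under `K`-algebra isomorphisms. [folklore] -/
theorem isSplitAt_congr {D' : Type*} [Ring D'] [Algebra K D'] (e : D ≃ₐ[K] D')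
    (v : HeightOneSpectrum (𝓞 K)) : IsSplitAt D v ↔ IsSplitAt D' v :=
  ScalarExtension.nonempty_algEquiv_iff_of_algEquiv K (v.adicCompletion K) e _

omit [NumberField K] in
/-- Being split at an infinite place is invariant under `K`-algebra isomorphisms. [folklore] -/
theorem isSplitAtInfinite_congr {D' : Type*} [Ring D'] [Algebra K D'] (e : D ≃ₐ[K] D')
    (w : InfinitePlace K) : IsSplitAtInfinite D w ↔ IsSplitAtInfinite D' w :=
  ScalarExtension.nonempty_algEquiv_iff_of_algEquiv K w.Completion e _

/-- A quaternion algebra `D ≃ ℍ[K,a,b]` over a number field is split at a finite place `v` iff the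
Hilbert symbol `(a, b)_v` (in `K_v`) is `1` (Vignéras Ch. II §1 Cor. 1.2 with Ch. III §3;
O'Meara 57:9 with §63B): `isSplitAt_quaternionAlgebra_iff` (`K_v ⊗ ℍ[K,a,b] ≃ M₂(K_v)` iff
`X² - aY² = b` is soluble in `K_v`) and `exists_sq_sub_mul_sq_iff_hilbertSymbol_eq_one`.
[cite: Omeara1963, §57 Prop. 57:9] -/
theorem isSplitAt_iff_hilbertSymbol_eq_one {a b : K} (ha : a ≠ 0) (hb : b ≠ 0)
    (e : D ≃ₐ[K] ℍ[K,a,b]) (v : HeightOneSpectrum (𝓞 K)) :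
    IsSplitAt D v ↔
      QuadraticForms.hilbertSymbol (v.adicCompletion K) (algebraMap K _ a) (algebraMap K _ b) = 1 := by
  haveI : CharZero (v.adicCompletion K) :=
    charZero_of_injective_algebraMap (algebraMap K _).injective
  rw [isSplitAt_congr K D e v, isSplitAt_quaternionAlgebra_iff K ha hb v]
  exact QuadraticForms.exists_sq_sub_mul_sq_iff_hilbertSymbol_eq_one ((map_ne_zero _).mpr ha)
    ((map_ne_zero _).mpr hb)

/-- A quaternion algebra `D ≃ ℍ[K,a,b]` over a number field is split at an infinite place `w` iff
`(a, b)_w = 1` in `K_w` (O'Meara 57:9 with §63B; Vignéras Ch. III §3).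
[cite: Omeara1963, §57 Prop. 57:9] -/
theorem isSplitAtInfinite_iff_hilbertSymbol_eq_one {a b : K} (ha : a ≠ 0) (hb : b ≠ 0)
    (e : D ≃ₐ[K] ℍ[K,a,b]) (w : InfinitePlace K) :
    IsSplitAtInfinite D w ↔ QuadraticForms.hilbertSymbol w.Completion (algebraMap K _ a) (algebraMap K _ b) = 1 := by
  haveI : CharZero w.Completion := charZero_of_injective_algebraMap (algebraMap K _).injective
  rw [isSplitAtInfinite_congr K D e w, isSplitAtInfinite_quaternionAlgebra_iff K ha hb w]
  exact QuadraticForms.exists_sq_sub_mul_sq_iff_hilbertSymbol_eq_one ((map_ne_zero _).mpr ha)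
    ((map_ne_zero _).mpr hb)

/-- The finite ramification set of `D ≃ ℍ[K,a,b]` is the set of finite places `v` with
`(a, b)_v = -1` (Vignéras Ch. III §1, Exemple: "Ram{a,b} = {v, (a,b)_v = -1}", from Ch. II §1
Cor. 1.2). [cite: VignerasLNM800, Ch. III §1 Exemple (Ram{a,b}), with Ch. II §1 Cor. 1.2] -/
theorem ramifiedPlaces_eq_of_algEquiv {a b : K} (ha : a ≠ 0) (hb : b ≠ 0)
    (e : D ≃ₐ[K] ℍ[K,a,b]) :
    ramifiedPlaces K D = {v : HeightOneSpectrum (𝓞 K) |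
      QuadraticForms.hilbertSymbol (v.adicCompletion K) (algebraMap K _ a) (algebraMap K _ b) = -1} := by
  ext v
  rw [mem_ramifiedPlaces_iff, isSplitAt_iff_hilbertSymbol_eq_one K D ha hb e v, Set.mem_setOf_eq]
  exact QuadraticForms.hilbertSymbol_ne_one_iff _ _

/-- The infinite ramification set of `D ≃ ℍ[K,a,b]` is the set of infinite places `w` with
`(a, b)_w = -1`. [cite: VignerasLNM800, Ch. III §1 Exemple (Ram{a,b}), with Ch. II §1 Cor. 1.2] -/
theorem ramifiedInfinitePlaces_eq_of_algEquiv {a b : K} (ha : a ≠ 0) (hb : b ≠ 0)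
    (e : D ≃ₐ[K] ℍ[K,a,b]) :
    ramifiedInfinitePlaces K D = {w : InfinitePlace K |
      QuadraticForms.hilbertSymbol w.Completion (algebraMap K _ a) (algebraMap K _ b) = -1} := by
  ext w
  rw [mem_ramifiedInfinitePlaces_iff, isSplitAtInfinite_iff_hilbertSymbol_eq_one K D ha hb e w,
    Set.mem_setOf_eq]
  exact QuadraticForms.hilbertSymbol_ne_one_iff _ _

/-- The infinite ramification set of `D ≃ ℍ[K,a,b]` is the set of real places at which `a` and
`b` are both negative (complex places are never ramified): `Ram_∞ = {w : (a, b)_w = -1}` and the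
archimedean evaluation of the Hilbert symbol (`setOf_hilbertSymbol_completion_eq_neg_one`,
`HilbertSymbolArchimedean.lean`). Vignéras Ch. III §1 Exemple; O'Meara §63B.
[cite: VignerasLNM800, Ch. III §1 Exemple (Ram{a,b})] -/
theorem ramifiedInfinitePlaces_eq_setOf_neg {a b : K} (ha : a ≠ 0) (hb : b ≠ 0)
    (e : D ≃ₐ[K] ℍ[K,a,b]) :
    ramifiedInfinitePlaces K D = {w : InfinitePlace K | ∃ hw : w.IsReal,
      InfinitePlace.embedding_of_isReal hw a < 0 ∧ InfinitePlace.embedding_of_isReal hw b < 0} := by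
  rw [ramifiedInfinitePlaces_eq_of_algEquiv K D ha hb e]
  exact QuadraticForms.setOf_hilbertSymbol_completion_eq_neg_one ha hb

/-- The finite ramification set of a quaternion algebra over a number field is finite (Vignéras
Ch. III §1 Lemme 1.1), here as a corollary of `Ram_f(D) = {v : (a, b)_v = -1}` and the finiteness
half of Hilbert reciprocity (`finite_setOf_hilbertSymbol_eq_neg_one`, O'Meara 71:18 first
assertion); the named fact itself is discharged in `QuaternionAlgebraAdelicRamificationProofs.lean`
(`ramifiedPlaces_finite_holds`). [cite: VignerasLNM800, Ch. III §1 Lemme 1.1] -/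
theorem finite_ramifiedPlaces' [IsQuaternionAlgebra K D] : (ramifiedPlaces K D).Finite := by
  haveI : NeZero (2 : K) := ⟨two_ne_zero⟩
  obtain ⟨a, b, ha, hb, ⟨e⟩⟩ := IsQuaternionAlgebra.exists_algEquiv_quaternionAlgebra K D
  rw [ramifiedPlaces_eq_of_algEquiv K D ha hb e]
  exact QuadraticForms.finite_setOf_hilbertSymbol_eq_neg_one K ha hb

/-- **Parity of ramification, reduced to Hilbert reciprocity** (Vignéras Ch. III §3, Thm. 3.1
with Cor. 3.3; O'Meara 71:18): if Hilbert's reciprocity law holds for `K` (the named fact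
`hilbertReciprocity K a b` for all `a b`), then every quaternion algebra over `K` is ramified at
an even number of places, i.e. `even_card_ramified K D`. With inputs 1–2 of the module docstring
proved, this is the classical proof "`|Ram H|` even ⇔ `∏_v (a,b)_v = 1`" (Vignéras III §3,
remark before Cor. 3.3). [cite: VignerasLNM800, Ch. III §3 Thm. 3.1] -/
theorem even_card_ramified_of_hilbertReciprocity (hHR : ∀ a b : K, QuadraticForms.hilbertReciprocity K a b) :
    even_card_ramified K D := by
  intro hD
  obtain ⟨a, b, ha, hb, ⟨e⟩⟩ := IsQuaternionAlgebra.exists_algEquiv_quaternionAlgebra K D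
  obtain ⟨-, heven⟩ := hHR a b ha hb
  rw [ramifiedPlaces_eq_of_algEquiv K D ha hb e, ramifiedInfinitePlaces_eq_of_algEquiv K D ha hb e]
  exact heven

end NumberField

end Literature.NumberTheory.Automorphic
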